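import Summits.AtomisticToContinuum.FouriersLaw.Theses.PhononMeanFreePath

/-!
# IncoherentChannel — load-bearing hypotheses, hidden fixed-`N` content, and exactness of the split (negative-side support)

Support lemmas for crux `PhononMeanFreePath.IncoherentChannel` (item stmt-AtomisticToContinuum-11811)
from the standing disprover's work file `Cruxes/IncoherentChannel/Disproof.lean` §1–§3, all
sorry-free, no new definitions (the crux's integrand is written out: `r_N(t) = ∫ p₀·(K_t p_N) dμ₀`,
`C_N(t) = ∫ p₀²(K_t p_N²) dμ₀ - (∫p₀² dμ₀)(∫K_t p_N² dμ₀)`, `a_N = N(γ²/T²)∫_{t>0}[C_N - 2r_N²]`):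

* hidden fixed-`N` content / junk-robustness: the crux forces, for all large `N`, the cumulant
  channel `t ↦ C_N(t) - 2 r_N(t)²` to be Lebesgue-integrable on `(0,∞)` with POSITIVE integral
  (`eventually_integral_pos_of_crux`, `eventually_integrableOn_of_crux`);
* each dropped positivity hypothesis gives a FALSE statement: `γ = 0` and `T = 0` (the prefactor
  `γ²/T²` vanishes, `a_N ≡ 0 ↛ κ > 0`: `crux_false_without_gammaPos`, `crux_false_without_TPos`);
  the harmonic corner `lam = β = 0` modulo the Gaussian (Wick) four-point identity `C_N ≡ 2r_N²`
  (`not_crux_harmonic_of_wick`) — any proof must use anharmonicity non-perturbatively;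
* exactness of the route's split: the converse of the deciding theorem `closes` —
  under `NessUnique`, `BoundaryKubo`, `CoherentDephasing` the crux is EQUIVALENT to the sub-problem
  conjunct `FouriersLaw` (`incoherentChannel_iff_fouriersLaw`): no refutation of the crux can be
  cheaper than a refutation of Fourier's law for the pinned anharmonic chain or of a sibling item.
-/

noncomputable section

open MeasureTheory Filter Topology Set
open Literature.MathematicalPhysics.KineticTheory.HeatConduction
open Summit.AtomisticToContinuum.FouriersLaw.Theses.PhononMeanFreePath

namespace Summit.AtomisticToContinuum.FouriersLaw.Theorems.IncoherentChannel.Negative.LoadBearing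

/-! ## 1. Hidden fixed-`N` content and junk-robustness -/

/-- A real sequence of the form `N · c · I_N` with `c ≥ 0` converging to a POSITIVE limit has
`I_N > 0` for all large `N`. [folklore] -/
theorem eventually_pos_of_tendsto {c κ : ℝ} {I : ℕ → ℝ} (hc : 0 ≤ c) (hκ : 0 < κ)
    (h : Tendsto (fun N : ℕ => (N : ℝ) * c * I N) atTop (𝓝 κ)) : ∀ᶠ N in atTop, 0 < I N := by
  filter_upwards [h.eventually (lt_mem_nhds hκ)] with N hN
  by_contra hI
  have h0 : 0 ≤ (N : ℝ) * c := by positivity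
  exact absurd hN (not_lt.2 (mul_nonpos_of_nonneg_of_nonpos h0 (not_lt.1 hI)))

/-- **The crux forces the time-integrated cumulant channel to be eventually POSITIVE**
(`∫_{t>0} [C_N - 2r_N²] > 0` for all large `N`): a sign prediction for equilibrium MD, and the
reason the statement cannot be junk-true. [folklore] -/
theorem eventually_integral_pos_of_crux (h : IncoherentChannel) {ω₂ lam β γ : ℝ} (hω : 0 < ω₂)
    (hl : 0 < lam) (hβ : 0 < β) (hγ : 0 < γ) {T : ℝ} (hT : 0 < T) :
    ∀ᶠ N : ℕ in atTop, 0 < ∫ t in Set.Ioi (0 : ℝ), (((∫ z, (z.2 0) ^ 2 * (∫ y, (y.2 (Fin.last N)) ^ 2 ∂((pinnedChain ω₂ lam β γ).transitionKernel (N + 1) T T t.toNNReal z)) ∂((pinnedChain ω₂ lam β γ).gibbsMeasure (N + 1) T)) - (∫ z, (z.2 0) ^ 2 ∂((pinnedChain ω₂ lam β γ).gibbsMeasure (N + 1) T)) * (∫ z, (∫ y, (y.2 (Fin.last N)) ^ 2 ∂((pinnedChain ω₂ lam β γ).transitionKernel (N + 1) T T t.toNNReal z)) ∂((pinnedChain ω₂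 lam β γ).gibbsMeasure (N + 1) T))) - 2 * (∫ z, z.2 0 * (∫ y, y.2 (Fin.last N) ∂((pinnedChain ω₂ lam β γ).transitionKernel (N + 1) T T t.toNNReal z)) ∂((pinnedChain ω₂ lam β γ).gibbsMeasure (N + 1) T)) ^ 2) := by
  obtain ⟨κ, hκ, hlim⟩ := h ω₂ lam β γ hω hl hβ hγ T hT
  exact eventually_pos_of_tendsto (I := fun N : ℕ => ∫ t in Set.Ioi (0 : ℝ), (((∫ z, (z.2 0) ^ 2 * (∫ y, (y.2 (Fin.last N)) ^ 2 ∂((pinnedChain ω₂ lam β γ).transitionKernel (N + 1) T T t.toNNReal z)) ∂((pinnedChain ω₂ lam β γ).gibbsMeasure (N + 1) T)) - (∫ z, (z.2 0) ^ 2 ∂((pinnedChain ω₂ lam β γ).gibbsMeasure (N + 1) T)) * (∫ z, (∫ y, (y.2 (Fin.last N)) ^ 2 ∂((pinnedChain ω₂ lam β γ).transitionKernel (N + 1) T T t.toNNReal z)) ∂((pinnedChain ω₂ lam β γ).gibbsMeasure (N + 1) T))) - 2 * (∫ z, z.2 0 * (∫ y, y.2 (Fin.last N) ∂((pinnedChain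 ω₂ lam β γ).transitionKernel (N + 1) T T t.toNNReal z)) ∂((pinnedChain ω₂ lam β γ).gibbsMeasure (N + 1) T)) ^ 2)) (by positivity) hκ hlim

/-- **Hidden fixed-`N` content**: the crux forces `t ↦ C_N(t) - 2 r_N(t)²` to be INTEGRABLE on
`(0, ∞)` for all large `N` (a non-integrable integrand has Bochner integral `0`). Any proof thus
contains a fixed-`N` mixing statement for these unbounded observables of the equilibrium open
chain over all times. [folklore] -/
theorem eventually_integrableOn_of_crux (h : IncoherentChannel) {ω₂ lam β γ : ℝ} (hω : 0 < ω₂)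
    (hl : 0 < lam) (hβ : 0 < β) (hγ : 0 < γ) {T : ℝ} (hT : 0 < T) :
    ∀ᶠ N : ℕ in atTop, IntegrableOn (fun t : ℝ => (((∫ z, (z.2 0) ^ 2 * (∫ y, (y.2 (Fin.last N)) ^ 2 ∂((pinnedChain ω₂ lam β γ).transitionKernel (N + 1) T T t.toNNReal z)) ∂((pinnedChain ω₂ lam β γ).gibbsMeasure (N + 1) T)) - (∫ z, (z.2 0) ^ 2 ∂((pinnedChain ω₂ lam β γ).gibbsMeasure (N + 1) T)) * (∫ z, (∫ y, (y.2 (Fin.last N)) ^ 2 ∂((pinnedChain ω₂ lam β γ).transitionKernel (N + 1) T T t.toNNReal z)) ∂((pinnedChain ω₂ lam β γ).gibbsMeasure (N + 1) T))) - 2 * (∫ z, z.2 0 * (∫ y, y.2 (Fin.last N) ∂((pinnedChain ω₂ lam β γ).transitionKernel (N + 1) T T t.toNNReal z)) ∂((pinnedChain ω₂ lam β γ).gibbsMeasure (N + 1) T)) ^ 2)) (Set.Ioi 0) := by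
  filter_upwards [eventually_integral_pos_of_crux h hω hl hβ hγ hT] with N hN
  by_contra hI
  rw [integral_undef hI] at hN
  exact lt_irrefl _ hN

/-! ## 2. Load-bearing hypotheses -/

/-- A sequence that vanishes identically does not tend to a positive limit. [folklore] -/
theorem not_exists_pos_limit_of_eq_zero {a : ℕ → ℝ} (h : ∀ N, a N = 0) :
    ¬ ∃ κ : ℝ, 0 < κ ∧ Tendsto a atTop (𝓝 κ) := by
  rintro ⟨κ, hκ, hlim⟩
  have ha : a = fun _ => 0 := funext h
  rw [ha] at hlim
  have hκ0 : κ = 0 := tendsto_nhds_unique hlim tendsto_const_nhds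
  exact (lt_irrefl (0 : ℝ)) (hκ0 ▸ hκ)

/-- **`0 < γ` is load-bearing** (as typed): with `0 ≤ γ` admitted, `γ = 0` (no baths) makes the
prefactor `γ²/T²` and hence `a_N` vanish identically, `a_N ≡ 0 ↛ κ > 0`. [folklore] -/
theorem crux_false_without_gammaPos :
    ¬ ∀ ω₂ lam β γ : ℝ, 0 < ω₂ → 0 < lam → 0 < β → 0 ≤ γ → ∀ T : ℝ, 0 < T →
      ∃ κ : ℝ, 0 < κ ∧ Tendsto (fun N : ℕ => (N : ℝ) * (γ ^ 2 / T ^ 2) * ∫ t in Set.Ioi (0 : ℝ), (((∫ z, (z.2 0) ^ 2 * (∫ y, (y.2 (Fin.last N)) ^ 2 ∂((pinnedChain ω₂ lam β γ).transitionKernel (N + 1) T T t.toNNReal z)) ∂((pinnedChain ω₂ lam β γ).gibbsMeasure (N + 1) T)) - (∫ z, (z.2 0) ^ 2 ∂((pinnedChain ω₂ lam β γ).gibbsMeasure (N + 1) T)) * (∫ z, (∫ y, (y.2 (Fin.last N)) ^ 2 ∂((pinnedChain ω₂ lam β γ).transitionKernel (N + 1) T T t.toNNReal z)) ∂((pinnedChain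 ω₂ lam β γ).gibbsMeasure (N + 1) T))) - 2 * (∫ z, z.2 0 * (∫ y, y.2 (Fin.last N) ∂((pinnedChain ω₂ lam β γ).transitionKernel (N + 1) T T t.toNNReal z)) ∂((pinnedChain ω₂ lam β γ).gibbsMeasure (N + 1) T)) ^ 2)) atTop (𝓝 κ) := by
  intro h
  refine not_exists_pos_limit_of_eq_zero (fun N => ?_) (h 1 1 1 0 one_pos one_pos one_pos le_rfl 1 one_pos)
  simp

/-- **`0 < T` is load-bearing** (as typed): with `0 ≤ T` admitted, `T = 0` makes the prefactor the
junk `γ²/0 = 0` (and the Gibbs measure `volume.tilted (-H/0)` the zero measure): `a_N ≡ 0`.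
[folklore] -/
theorem crux_false_without_TPos :
    ¬ ∀ ω₂ lam β γ : ℝ, 0 < ω₂ → 0 < lam → 0 < β → 0 < γ → ∀ T : ℝ, 0 ≤ T →
      ∃ κ : ℝ, 0 < κ ∧ Tendsto (fun N : ℕ => (N : ℝ) * (γ ^ 2 / T ^ 2) * ∫ t in Set.Ioi (0 : ℝ), (((∫ z, (z.2 0) ^ 2 * (∫ y, (y.2 (Fin.last N)) ^ 2 ∂((pinnedChain ω₂ lam β γ).transitionKernel (N + 1) T T t.toNNReal z)) ∂((pinnedChain ω₂ lam β γ).gibbsMeasure (N + 1) T)) - (∫ z, (z.2 0) ^ 2 ∂((pinnedChain ω₂ lam β γ).gibbsMeasure (N + 1) T)) * (∫ z, (∫ y, (y.2 (Fin.last N)) ^ 2 ∂((pinnedChain ω₂ lam β γ).transitionKernel (N + 1) T T t.toNNReal z)) ∂((pinnedChain ω₂ lam β γ).gibbsMeasure (N + 1) T))) - 2 * (∫ z, z.2 0 * (∫ y, y.2 (Fin.last N) ∂((pinnedChain ω₂ lam β γ).transitionKernel (N + 1) T T t.toNNReal z)) ∂((pinnedChain ω₂ lam β γ).gibbsMeasure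 (N + 1) T)) ^ 2)) atTop (𝓝 κ) := by
  intro h
  refine not_exists_pos_limit_of_eq_zero (fun N => ?_) (h 1 1 1 1 one_pos one_pos one_pos one_pos 0 le_rfl)
  simp

/-- **Anharmonicity is load-bearing, modulo the Wick identity.** For the pinned HARMONIC chain
(`lam = β = 0`) started in its Gaussian Gibbs state, `(p₀(0), p_N(t))` is a centred jointly Gaussian
pair, so `Cov(p₀², p_N(t)²) = 2 Cov(p₀, p_N(t))²` (Isserlis), i.e. `C_N ≡ 2 r_N²` and the cumulant
channel is EMPTY: taking that identity as hypothesis (its tree proof needs the identification of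
`transitionKernel` at `lam = β = 0` with the Ornstein–Uhlenbeck law, the missing link shared with
item stmt-11814), the crux's conclusion FAILS at `lam = β = 0` — all harmonic transport is
coherent/ballistic (`HarmonicChainBallisticFlux`). [cite: RiederLebowitzLieb1967] -/
theorem not_crux_harmonic_of_wick {ω₂ γ T : ℝ}
    (hW : ∀ (N : ℕ) (t : ℝ), 0 < t → ((∫ z, (z.2 0) ^ 2 * (∫ y, (y.2 (Fin.last N)) ^ 2 ∂((pinnedChain ω₂ 0 0 γ).transitionKernel (N + 1) T T t.toNNReal z)) ∂((pinnedChain ω₂ 0 0 γ).gibbsMeasure (N + 1) T)) - (∫ z, (z.2 0) ^ 2 ∂((pinnedChain ω₂ 0 0 γ).gibbsMeasure (N + 1) T)) * (∫ z, (∫ y, (y.2 (Fin.last N)) ^ 2 ∂((pinnedChain ω₂ 0 0 γ).transitionKernel (N + 1) T T t.toNNReal z)) ∂((pinnedChain ω₂ 0 0 γ).gibbsMeasure (N + 1) T))) = 2 * (∫ z, z.2 0 * (∫ y, y.2 (Fin.last N) ∂((pinnedChain ω₂ 0 0 γ).transitionKernel (N + 1) T T t.toNNReal z)) ∂((pinnedChain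 ω₂ 0 0 γ).gibbsMeasure (N + 1) T)) ^ 2) :
    ¬ ∃ κ : ℝ, 0 < κ ∧ Tendsto (fun N : ℕ => (N : ℝ) * (γ ^ 2 / T ^ 2) * ∫ t in Set.Ioi (0 : ℝ), (((∫ z, (z.2 0) ^ 2 * (∫ y, (y.2 (Fin.last N)) ^ 2 ∂((pinnedChain ω₂ 0 0 γ).transitionKernel (N + 1) T T t.toNNReal z)) ∂((pinnedChain ω₂ 0 0 γ).gibbsMeasure (N + 1) T)) - (∫ z, (z.2 0) ^ 2 ∂((pinnedChain ω₂ 0 0 γ).gibbsMeasure (N + 1) T)) * (∫ z, (∫ y, (y.2 (Fin.last N)) ^ 2 ∂((pinnedChain ω₂ 0 0 γ).transitionKernel (N + 1) T T t.toNNReal z)) ∂((pinnedChain ω₂ 0 0 γ).gibbsMeasure (N + 1) T))) - 2 * (∫ z, z.2 0 * (∫ y, y.2 (Fin.last N) ∂((pinnedChain ω₂ 0 0 γ).transitionKernel (N + 1) T T t.toNNReal z)) ∂((pinnedChain ω₂ 0 0 γ).gibbsMeasure (N + 1) T)) ^ 2)) atTop (𝓝 κ) := by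
  refine not_exists_pos_limit_of_eq_zero fun N => ?_
  have h : ∫ t in Set.Ioi (0 : ℝ), (((∫ z, (z.2 0) ^ 2 * (∫ y, (y.2 (Fin.last N)) ^ 2 ∂((pinnedChain ω₂ 0 0 γ).transitionKernel (N + 1) T T t.toNNReal z)) ∂((pinnedChain ω₂ 0 0 γ).gibbsMeasure (N + 1) T)) - (∫ z, (z.2 0) ^ 2 ∂((pinnedChain ω₂ 0 0 γ).gibbsMeasure (N + 1) T)) * (∫ z, (∫ y, (y.2 (Fin.last N)) ^ 2 ∂((pinnedChain ω₂ 0 0 γ).transitionKernel (N + 1) T T t.toNNReal z)) ∂((pinnedChain ω₂ 0 0 γ).gibbsMeasure (N + 1) T))) - 2 * (∫ z, z.2 0 * (∫ y, y.2 (Fin.last N) ∂((pinnedChain ω₂ 0 0 γ).transitionKernel (N + 1) T T t.toNNReal z)) ∂((pinnedChain ω₂ 0 0 γ).gibbsMeasure (N + 1) T)) ^ 2) = ∫ t in Set.Ioi (0 : ℝ), (0 : ℝ) := by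
    refine setIntegral_congr_fun measurableSet_Ioi fun t ht => ?_
    rw [hW N t ht, sub_self]
  rw [h]
  simp

/-- Hence the crux with `0 ≤ lam`, `0 ≤ β` admitted is false as soon as the Wick identity holds at
one admissible `(ω₂, γ, T)`. [folklore] -/
theorem crux_false_without_anharmonicity_of_wick {ω₂ γ T : ℝ} (hω : 0 < ω₂) (hγ : 0 < γ)
    (hT : 0 < T) (hW : ∀ (N : ℕ) (t : ℝ), 0 < t → ((∫ z, (z.2 0) ^ 2 * (∫ y, (y.2 (Fin.last N)) ^ 2 ∂((pinnedChain ω₂ 0 0 γ).transitionKernel (N + 1) T T t.toNNReal z)) ∂((pinnedChain ω₂ 0 0 γ).gibbsMeasure (N + 1) T)) - (∫ z, (z.2 0) ^ 2 ∂((pinnedChain ω₂ 0 0 γ).gibbsMeasure (N + 1) T)) * (∫ z, (∫ y, (y.2 (Fin.last N)) ^ 2 ∂((pinnedChain ω₂ 0 0 γ).transitionKernel (N + 1) T T t.toNNReal z)) ∂((pinnedChain ω₂ 0 0 γ).gibbsMeasure (N + 1) T))) = 2 * (∫ z, z.2 0 * (∫ y, y.2 (Fin.last N) ∂((pinnedChain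 ω₂ 0 0 γ).transitionKernel (N + 1) T T t.toNNReal z)) ∂((pinnedChain ω₂ 0 0 γ).gibbsMeasure (N + 1) T)) ^ 2) :
    ¬ ∀ ω₂ lam β γ : ℝ, 0 < ω₂ → 0 ≤ lam → 0 ≤ β → 0 < γ → ∀ T : ℝ, 0 < T →
      ∃ κ : ℝ, 0 < κ ∧ Tendsto (fun N : ℕ => (N : ℝ) * (γ ^ 2 / T ^ 2) * ∫ t in Set.Ioi (0 : ℝ), (((∫ z, (z.2 0) ^ 2 * (∫ y, (y.2 (Fin.last N)) ^ 2 ∂((pinnedChain ω₂ lam β γ).transitionKernel (N + 1) T T t.toNNReal z)) ∂((pinnedChain ω₂ lam β γ).gibbsMeasure (N + 1) T)) - (∫ z, (z.2 0) ^ 2 ∂((pinnedChain ω₂ lam β γ).gibbsMeasure (N + 1) T)) * (∫ z, (∫ y, (y.2 (Fin.last N)) ^ 2 ∂((pinnedChain ω₂ lam β γ).transitionKernel (N + 1) T T t.toNNReal z)) ∂((pinnedChain ω₂ lam β γ).gibbsMeasure (N + 1) T))) - 2 * (∫ z, z.2 0 * (∫ y, y.2 (Fin.last N) ∂((pinnedChain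 ω₂ lam β γ).transitionKernel (N + 1) T T t.toNNReal z)) ∂((pinnedChain ω₂ lam β γ).gibbsMeasure (N + 1) T)) ^ 2)) atTop (𝓝 κ) := fun h =>
  not_crux_harmonic_of_wick hW (h ω₂ 0 0 γ hω le_rfl le_rfl hγ T hT)

/-! ## 3. Exactness of the split: under the sibling items the crux is Fourier's law -/

/-- **Converse of the route's deciding theorem `closes`.** Given weak-NESS uniqueness, the boundary
Kubo identity and coherent dephasing, the sub-problem conjunct `FouriersLaw` implies the crux:
along the canonical steady-state family `D_{N+1} = N(γ²/T²)∫C_N → κ(T)` (uniqueness of limits on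
`𝓝[≠] 0`), the coherent part `2(γ²/T²)·N∫r_N² → 0`, so `a_N → κ(T) > 0`; together with `closes`
this is an equivalence. [cite: BonettoLebowitzReyBellet2000, §5.3 eq. (33)] -/
theorem incoherentChannel_iff_fouriersLaw (hU : NessUnique) (hK : BoundaryKubo)
    (hA : CoherentDephasing) : IncoherentChannel ↔ _root_.FouriersLaw := by
  refine ⟨closes hU hK hA, fun hF => ?_⟩
  intro ω₂ lam β γ hω hl hβ hγ T hT
  obtain ⟨-, κ, hκpos, hκ⟩ := hF ω₂ lam β γ hω hl hβ hγ
  classical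
  let μ : (N : ℕ) → ℝ → ℝ → Measure (PhaseSpace N) := fun N T_L T_R =>
    if h : 0 < T_L ∧ 0 < T_R then
      Classical.choose (pinnedChain_exists_isSteadyState hω hl hβ hγ N h.1 h.2) else 0
  have hμ : ∀ (N : ℕ) (T_L T_R : ℝ), 0 < T_L → 0 < T_R →
      (pinnedChain ω₂ lam β γ).IsSteadyState N T_L T_R (μ N T_L T_R) := by
    intro N T_L T_R hL hR
    simp only [μ, dif_pos (And.intro hL hR)]
    exact Classical.choose_spec (pinnedChain_exists_isSteadyState hω hl hβ hγ N hL hR)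
  obtain ⟨D, hD, hDlim⟩ := hκ μ hμ T hT
  have hKT := hK ω₂ lam β γ hω hl hβ hγ (hU ω₂ lam β γ hω hl hβ hγ) μ hμ T hT
  have hAT := hA ω₂ lam β γ hω hl hβ hγ T hT
  -- name the two channel functions
  set Cf : ℕ → ℝ → ℝ := fun N t => ((∫ z, (z.2 0) ^ 2 * (∫ y, (y.2 (Fin.last N)) ^ 2 ∂((pinnedChain ω₂ lam β γ).transitionKernel (N + 1) T T t.toNNReal z)) ∂((pinnedChain ω₂ lam β γ).gibbsMeasure (N + 1) T)) - (∫ z, (z.2 0) ^ 2 ∂((pinnedChain ω₂ lam β γ).gibbsMeasure (N + 1) T)) * (∫ z, (∫ y, (y.2 (Fin.last N)) ^ 2 ∂((pinnedChain ω₂ lam β γ).transitionKernel (N + 1) T T t.toNNReal z)) ∂((pinnedChain ω₂ lam β γ).gibbsMeasure (N + 1) T))) with hCf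
  set rf : ℕ → ℝ → ℝ := fun N t => (∫ z, z.2 0 * (∫ y, y.2 (Fin.last N) ∂((pinnedChain ω₂ lam β γ).transitionKernel (N + 1) T T t.toNNReal z)) ∂((pinnedChain ω₂ lam β γ).gibbsMeasure (N + 1) T)) with hrf
  have hDK : ∀ N : ℕ, D (N + 1) = (N : ℝ) * (γ ^ 2 / T ^ 2) * ∫ t in Set.Ioi (0 : ℝ), Cf N t :=
    fun N => tendsto_nhds_unique (hD (N + 1)) (hKT N).2
  have hC : Tendsto (fun N : ℕ => (N : ℝ) * (γ ^ 2 / T ^ 2) * ∫ t in Set.Ioi (0 : ℝ), Cf N t)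
      atTop (𝓝 (κ T)) := by
    refine (hDlim.comp (tendsto_add_atTop_nat 1)).congr fun N => ?_
    simp only [Function.comp_apply, hDK]
  have hr : Tendsto (fun N : ℕ => (N : ℝ) * ∫ t in Set.Ioi (0 : ℝ), rf N t ^ 2) atTop (𝓝 0) := hAT.2
  refine ⟨κ T, hκpos T hT, ?_⟩
  have hsplit : ∀ N : ℕ, (N : ℝ) * (γ ^ 2 / T ^ 2) * (∫ t in Set.Ioi (0 : ℝ), (Cf N t - 2 * rf N t ^ 2)) =
      (N : ℝ) * (γ ^ 2 / T ^ 2) * (∫ t in Set.Ioi (0 : ℝ), Cf N t) -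
        2 * (γ ^ 2 / T ^ 2) * ((N : ℝ) * ∫ t in Set.Ioi (0 : ℝ), rf N t ^ 2) := by
    intro N
    have hIC : IntegrableOn (Cf N) (Set.Ioi 0) := (hKT N).1
    have hIr : IntegrableOn (fun t => 2 * rf N t ^ 2) (Set.Ioi 0) := (hAT.1 N).const_mul 2
    rw [integral_sub hIC hIr, integral_const_mul]
    ring
  show Tendsto (fun N : ℕ => (N : ℝ) * (γ ^ 2 / T ^ 2) * ∫ t in Set.Ioi (0 : ℝ), (Cf N t - 2 * rf N t ^ 2))
    atTop (𝓝 (κ T))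
  simp_rw [hsplit]
  simpa using hC.sub (hr.const_mul (2 * (γ ^ 2 / T ^ 2)))

end Summit.AtomisticToContinuum.FouriersLaw.Theorems.IncoherentChannel.Negative.LoadBearing
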